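import Literature.AlgebraicGeometry.Motives.AbelianVarietyProduct
import Literature.AlgebraicGeometry.Motives.AbelianVarietyProjectiveChart
import Literature.AlgebraicGeometry.HodgeTheory.WeilClassesFourfoldsProofs
import Literature.AlgebraicGeometry.HodgeTheory.HodgeModelExistence
import Literature.AlgebraicGeometry.HodgeTheory.HodgeTypePullback
import Literature.AlgebraicGeometry.HodgeTheory.CupPreservesHodgeTypeOfDeRham
import Literature.AlgebraicGeometry.HodgeTheory.HodgeFiltrationModelsReductionProofs
import Literature.NumberTheory.Transcendental.DeRhamTheorem
import HarnessLib

/-!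
# Crux `WeilSixfoldsSqrtMinus7` (stmt-HodgeConjecture-1260), line `hyperbolic-eightfold-descent` — stub `stub_hodgeTypeExterior`

Künneth for Hodge types of exterior products on a product of complex abelian varieties, GRANTED
the two Literature named facts it consumes:

* (a) `∀ m Y, Literature.AlgebraicGeometry.HodgeTheory.nonempty_hodgeModel m Y` — every smooth
  projective complex variety has a Hodge model (Serre GAGA + de Rham + the Hodge decomposition);
* (b) `∀ E, Literature.NumberTheory.Transcendental.exists_deRhamIsoFamily 𝓘(ℝ, E)` — de Rham's
  theorem as a natural, multiplicative, normalised family (Warner Thm. 5.36 / 5.45).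

Statement (registered stub S4 of the line's skeleton, VERBATIM the sibling crux 1261's S4): for
complex abelian varieties `A`, `B` of dimensions `a`, `b` and classes `c ∈ Hᵏ(A(ℂ); ℂ)` of Hodge
type `(p, q)`, `w ∈ Hˡ(B(ℂ); ℂ)` of type `(p', q')`, the exterior product `pr_A^* c ⌣ pr_B^* w` is
of type `(p + p', q + q')` on `A.prod B` with dimension parameter `a + b`
(Voisin I §11.3.2 / Thm. 11.38; §7.3.2 and Thm. 5.29).

Proof: every ingredient is a theorem of the tree — abelian varieties are smooth projective of
their dimension (`Motives.AbelianVariety.isSmoothProjective_holds`), products of smooth projective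
varieties are smooth projective of the summed dimension (`isSmoothProjective_prod`), the Hodge
`(p,q)`-spaces are independent of the Hodge model (`hodgePQ_independent_of_hodgeModel_holds`),
hence pull-backs along `fst`, `snd` preserve Hodge types (`preservesHodgeType_of_nonempty_hodgeModel`,
fact (a)) and the cup product respects the bigrading on `A × B`
(`cupPreservesHodgeType_of_nonempty_hodgeModel`, facts (a) and (b)); conclude with
`isOfHodgeType_cupProduct_map_fst_map_snd`.
-/

noncomputable section

-- single-problem summit (Problem = Summit): the mandated namespace repeats `HodgeConjecture`.
set_option linter.dupNamespace false

open CategoryTheory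
open Literature.AlgebraicGeometry Literature.AlgebraicGeometry.Motives
  Literature.AlgebraicGeometry.HodgeTheory Literature.AlgebraicTopology.SingularHomology

namespace Summit.HodgeConjecture.HodgeConjecture.Theorems.WeilSixfoldsSqrtMinus7.HyperbolicEightfoldDescent

/-- **Stub 4 — Hodge types of exterior products (Künneth for Hodge models), from the two named
facts it consumes.** Granted (a) `nonempty_hodgeModel m Y` for all `m, Y` and (b) de Rham's
theorem `exists_deRhamIsoFamily 𝓘(ℝ, E)` for every finite-dimensional complex model space: for
complex abelian varieties `A`, `B` of dimensions `a`, `b` and classes `c ∈ Hᵏ(A(ℂ); ℂ)` of type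
`(p, q)`, `w ∈ Hˡ(B(ℂ); ℂ)` of type `(p', q')`, the exterior product `pr_A^* c ⌣ pr_B^* w` is of
type `(p + p', q + q')` on `A.prod B` with dimension parameter `a + b`
(Voisin I §11.3.2 / Thm. 11.38). -/
theorem stub_hodgeTypeExterior :
    (∀ (m : ℕ) (Y : SchemeOver ℂ), nonempty_hodgeModel m Y) →
    (∀ (E : Type) [NormedAddCommGroup E] [NormedSpace ℂ E] [FiniteDimensional ℂ E],
      Literature.NumberTheory.Transcendental.exists_deRhamIsoFamily (modelWithCornersSelf ℝ E)) →
    ∀ (A B : AbelianVariety ℂ) (a b : ℕ), A.dim = a → B.dim = b →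
    ∀ (k l m : ℕ) (hklm : k + l = m) (p q p' q' : ℕ)
      (c : complexBetti A.X k) (w : complexBetti B.X l),
      IsOfHodgeType a A.X k p q c → IsOfHodgeType b B.X l p' q' w →
      IsOfHodgeType (a + b) (A.prod B).X m (p + p') (q + q')
        (cupProduct hklm (complexBetti.map (AbelianVariety.fst A B).hom.hom.hom k c)
          (complexBetti.map (AbelianVariety.snd A B).hom.hom.hom l w)) := by
  intro hM hdR A B a b hA hB k l m hklm p q p' q' c w hc hw
  subst hA hB
  -- abelian varieties and their products are smooth projective of the expected dimensions
  have hA' : IsSmoothProjective A.dim A.X := AbelianVariety.isSmoothProjective_holds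
  have hB' : IsSmoothProjective B.dim B.X := AbelianVariety.isSmoothProjective_holds
  have hAB : IsSmoothProjective (A.dim + B.dim) (A.prod B).X := isSmoothProjective_prod hA' hB'
  -- `pr_A^*`, `pr_B^*` preserve Hodge types (fact (a)); `⌣` respects the bigrading (facts (a), (b))
  have hI := hodgePQ_independent_of_hodgeModel_holds
  have hfst : PreservesHodgeType (A.dim + B.dim) A.dim (AbelianVariety.fst A B).hom.hom.hom :=
    preservesHodgeType_of_nonempty_hodgeModel hI (hM _ _) hAB hA' _
  have hsnd : PreservesHodgeType (A.dim + B.dim) B.dim (AbelianVariety.snd A B).hom.hom.hom :=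
    preservesHodgeType_of_nonempty_hodgeModel hI (hM _ _) hAB hB' _
  have hcup : CupPreservesHodgeType (A.dim + B.dim) (A.prod B).X :=
    cupPreservesHodgeType_of_nonempty_hodgeModel hI (hM _ _) hdR hAB
  exact isOfHodgeType_cupProduct_map_fst_map_snd hklm hfst hsnd hcup hc hw

end Summit.HodgeConjecture.HodgeConjecture.Theorems.WeilSixfoldsSqrtMinus7.HyperbolicEightfoldDescent
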